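import Literature.Barriers.ValiantsHypothesis.BIJL18Thm4StrengthenedSemantics
import Literature.Computability.Complexity.E3SATBoundedOccurrence
import HarnessLib

/-!
# Bläser–Ikenmeyer–Jindal–Lysikov 2018, Thm 4 STRENGTHENED: the graded bounded-occurrence instance
# family and the E3SAT-level soundness / completeness of the two tests

Theorem-only companion of `BIJL18MatrixCompletion.lean` (typed fact `BIJL2018_thm4_strengthened K`, ECCC
TR18-064 p. 12, the remark after Obs. 17: "There are infinite sequences `t_n = Θ(n)` and `r_n = Θ(n)` and a
constant `c` such that for every set of equations describing the variety `C^{n,t_n,c}_{r_n}`, at least one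
equation has superpolynomial circuit complexity, unless `coNP ⊆ ∃BPP`"), third brick of the val-lit
`BIJL2018_thm4_strengthened` roster (F-S0 `E3SATBoundedOccurrence.lean`: the bounded-occurrence E3SAT language,
the Garey–Johnson–Stockmeyer occurrence bound, the padding `padE3`; F-S1 `BIJL18Thm4StrengthenedSemantics.lean`
(val-lit p7): the chart-test circuit `chartCircuitC n m c r` with a constant slice-rank bound and its block-level
soundness / completeness).

What this file fixes (DISCLOSED DEVIATION: none of it is spelled out in print, where the strengthened statement
is a one-sentence remark; the printed proof of Thm 4 reduces from plain Max-2-SAT, whose tensors have slices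
`A_k` of rank = number of literal positions on `x_k`, unbounded — the "constant `c`" of Obs. 17 presupposes a
bounded-occurrence source):

* §1 the GRADED INSTANCE FAMILY: `tSeq n = n + 1`, `rSeq n = 13 ⌊n/20⌋`, `cOf B = 20 (B + 1)` and their linear
  growth (`growth_tSeq_rSeq`); the instance of an E3-CNF `φ` at padding `n₀`: `psi n₀ φ = gjs (padE3 n₀ φ)`
  (`10 m′` clauses, `m′ = |φ| + n₀`), matrix size `n = nOf ψ = 20 m′`, `m = n + 1 = tOf ψ` slices, threshold
  `7 m′`, rank bound `r = 13 m′ = rSeq n` (`nOf_psi`, `tOf_psi`, `rSeq_nOf_psi`, `le_nOf_psi`);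
* §2 the slice count read as `n + 1` instead of `tOf ψ` (`borderCompletionRank_slicesOfList_succ`, by
  `borderCompletionRank_reindex`) and Lemma 14 for `ψ` in that reading (`not_satisfiable_iff_lt_borderCompletionRank`:
  `φ` unsatisfiable iff `\underline{CR}(T_ψ) > r`, through `padE3`, GJS and p7's
  `not_exists_numSatClauses_iff_lt_borderCompletionRank`);
* §3 the SLICE-RANK BOUND `rank (A_k(T_ψ)) ≤ cOf B` for E3-CNFs with occurrence bound `B ≥ 1`
  (`rank_slicesOfList_psi_le`, from p7's `rank_slicesOfList_entries_le` and `varOcc_gjs_le`);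
* §4 SOUNDNESS `not_satisfiable_of_testsC` and COMPLETENESS `exists_block_of_not_satisfiable` of the two tests at
  the E3SAT level over every infinite field (chart identity over `K`, evaluation value nonzero in `K`), the latter
  from a set `S` of equations of `C^{n,n+1,cOf B}_{rSeq n}` all of whose members have small constant-free circuits
  (p7's `exists_block_of_equationsC`); and the same read modulo the characteristic (`_zmod`).

No new definition of the barrier file is touched, no named fact. HONEST FRAMING (val-lit): plumbing of a printed
`∃BPP` verifier for a CONDITIONAL barrier about the varieties `C^{n,t,c}_r`; nothing about `VP`; `VP ≠ VNP` is
NOT proved.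

## References

* [BlaserIkenmeyerJindalLysikov2018] M. Bläser, C. Ikenmeyer, G. Jindal, V. Lysikov, *Generalized matrix
  completion and algebraic natural proofs*, STOC 2018 / ECCC TR18-064: Thm 4 (proof, pp. 11–12), Lemma 14,
  Lemma 16, Obs 17 and the remark after it (p. 12).
* [GareyJohnsonStockmeyer1976] M. R. Garey, D. S. Johnson, L. Stockmeyer, TCS 1 (1976), Thm. 1.1.
-/

noncomputable section

open MvPolynomial

namespace Literature.Barriers.ValiantsHypothesis

namespace BIJL2018Thm4S

open Literature.Computability.AlgebraicComplexity Literature.Computability.Complexity ArithCircuit KIReduction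
open BILPS2019Cor42 (evalCircuit)
open CNF MaxTwoSat BIJL18NPHard BIJL2018Thm4

universe u

/-! ### §1. The graded instance family -/

/-- **The number of slices along the family**: `t_n = n + 1` (`= 2s + 1` slices of the Thm-3 tensor of a
2-CNF with `s` clauses, `n = 2s`). [cite: BlaserIkenmeyerJindalLysikov2018, §3 remark after Obs. 17 ("t_n = Θ(n)")] -/
def tSeq (n : ℕ) : ℕ := n + 1

/-- **The rank bound along the family**: `r_n = 13 ⌊n / 20⌋` (`= 2s − 7m′` for the Garey–Johnson–Stockmeyer
2-CNF of an E3-CNF with `m′` clauses: `s = 10 m′`, `n = 20 m′`). [cite: BlaserIkenmeyerJindalLysikov2018, §3 remark after Obs. 17 ("r_n = Θ(n)")] -/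
def rSeq (n : ℕ) : ℕ := 13 * (n / 20)

/-- **The slice-rank constant** for instances coming from E3-CNFs with occurrence bound `B`: `20 (B + 1)`.
[cite: BlaserIkenmeyerJindalLysikov2018, Obs. 17 ("rk(A_i) ≤ c for all i for some constant c")] -/
def cOf (B : ℕ) : ℕ := 20 * (B + 1)

/-- **Linear growth** `t_n = Θ(n)`, `r_n = Θ(n)`: for `n ≥ 40`, `n ≤ 4 t_n`, `t_n ≤ 2n`, `n ≤ 4 r_n`, `r_n ≤ 2n`.
[cite: BlaserIkenmeyerJindalLysikov2018, §3 remark after Obs. 17] -/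
theorem growth_tSeq_rSeq (n : ℕ) (hn : 40 ≤ n) :
    n ≤ 4 * tSeq n ∧ tSeq n ≤ 2 * n ∧ n ≤ 4 * rSeq n ∧ rSeq n ≤ 2 * n := by
  unfold tSeq rSeq; omega

/-- **The 2-CNF of the instance**: the Garey–Johnson–Stockmeyer 2-CNF of the padded E3-CNF.
[cite: BlaserIkenmeyerJindalLysikov2018, Thm. 4 (proof: "Let T_φ = (A_0,…,A_t) be the corresponding tensor")] [cite: GareyJohnsonStockmeyer1976, Thm. 1.1] -/
def psi (n₀ : ℕ) (φ : CNF ℕ) : CNF ℕ := gjs (padE3 n₀ φ)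

/-- `ψ` has `10 (|φ| + n₀)` clauses. [cite: GareyJohnsonStockmeyer1976, Thm. 1.1] -/
theorem length_psi (n₀ : ℕ) (φ : CNF ℕ) : (psi n₀ φ).length = 10 * (φ.length + n₀) := by
  rw [psi, length_gjs, length_padE3]

/-- `ψ` is a 2-CNF. [cite: GareyJohnsonStockmeyer1976, Thm. 1.1] -/
theorem isWidthEq_two_psi (n₀ : ℕ) (φ : CNF ℕ) : IsWidthEq 2 (psi n₀ φ) := isWidthEq_two_gjs _

/-- The matrix size `n = 20 (|φ| + n₀)`. [cite: BlaserIkenmeyerJindalLysikov2018, §3 ("n = 2s")] -/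
theorem nOf_psi (n₀ : ℕ) (φ : CNF ℕ) : nOf (psi n₀ φ) = 20 * (φ.length + n₀) := by
  rw [nOf, length_psi]; ring

/-- The slice count `tOf ψ = n + 1`. [cite: BlaserIkenmeyerJindalLysikov2018, §3 ("m = t")] -/
theorem tOf_psi (n₀ : ℕ) (φ : CNF ℕ) : tOf (psi n₀ φ) = nOf (psi n₀ φ) + 1 := by
  rw [tOf, nOf]; ring

/-- The rank bound at this size: `rSeq n = 13 (|φ| + n₀)`. [cite: BlaserIkenmeyerJindalLysikov2018, Thm. 4 (proof: "r_0 = 2s − b")] -/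
theorem rSeq_nOf_psi (n₀ : ℕ) (φ : CNF ℕ) : rSeq (nOf (psi n₀ φ)) = 13 * (φ.length + n₀) := by
  rw [rSeq, nOf_psi]; omega

/-- `r = 2s − b` with `s = 10 m′`, `b = 7 m′`. [cite: BlaserIkenmeyerJindalLysikov2018, Thm. 4 (proof: "r_0 = 2s − b")] -/
theorem rSeq_eq_sub (n₀ : ℕ) (φ : CNF ℕ) :
    13 * (φ.length + n₀) = 2 * (psi n₀ φ).length - 7 * (padE3 n₀ φ).length := by
  rw [length_psi, length_padE3]; omega

/-- The padding pushes the size above `n₀`. [cite: BlaserIkenmeyerJindalLysikov2018, Thm. 4 (proof: "let n be large enough")] -/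
theorem le_nOf_psi (n₀ : ℕ) (φ : CNF ℕ) : n₀ ≤ nOf (psi n₀ φ) := by
  rw [nOf_psi]; omega

/-- The size is at least `20 n₀`. [cite: BlaserIkenmeyerJindalLysikov2018, Thm. 4 (proof: "let n be large enough")] -/
theorem mul_le_nOf_psi (n₀ : ℕ) (φ : CNF ℕ) : 20 * n₀ ≤ nOf (psi n₀ φ) := by
  rw [nOf_psi]; omega

/-! ### §2. The slice count read as `n + 1`; Lemma 14 for `ψ` -/

section Transport

variable (K : Type u) [Field K]

/-- Reading the slices with slice count `m` or `m'` (`m = m'`) gives the same matrices. [cite: BlaserIkenmeyerJindalLysikov2018, §1.4] -/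
theorem slicesOfList_finCongr {n m m' : ℕ} (h : m = m') (l : List ℤ) (k : Fin m) :
    slicesOfList K n m' l (finCongr h k) = slicesOfList K n m l k := rfl

/-- **Border completion rank does not depend on how the slice count is spelled.**
[cite: BlaserIkenmeyerJindalLysikov2018, Def. 9] -/
theorem borderCompletionRank_slicesOfList_congr {n m m' : ℕ} (h : m = m') (l : List ℤ) :
    borderCompletionRank (slice₀OfList K n l) (slicesOfList K n m' l) =
      borderCompletionRank (slice₀OfList K n l) (slicesOfList K n m l) := by
  have e := borderCompletionRank_reindex (Equiv.refl (Fin n)) (finCongr h.symm)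
    (slice₀OfList K n l) (slicesOfList K n m l)
  have h0 : (slice₀OfList K n l).reindex (Equiv.refl (Fin n)) (Equiv.refl (Fin n)) = slice₀OfList K n l := by
    ext i j; rfl
  have h1 : (fun k' => (slicesOfList K n m l (finCongr h.symm k')).reindex (Equiv.refl (Fin n)) (Equiv.refl (Fin n))) =
      slicesOfList K n m' l := by
    funext k'; ext i j; rfl
  rw [h0, h1] at e
  exact e

/-- **Lemma 14 for the instance of an E3-CNF** (slices counted as `n + 1`): `φ` is unsatisfiable iff the
coded tensor `T_ψ` has border completion rank `> 13 (|φ| + n₀)` — `φ` unsatisfiable ⟺ `padE3 n₀ φ`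
unsatisfiable ⟺ fewer than `7 m′` clauses of `ψ` satisfiable (Garey–Johnson–Stockmeyer) ⟺
`\underline{CR}(T_ψ) > 2s − 7m′` (Lemma 14 on the coded tensor).
[cite: BlaserIkenmeyerJindalLysikov2018, Thm. 4 (proof) and Lemma 14] [cite: GareyJohnsonStockmeyer1976, Thm. 1.1] -/
theorem not_satisfiable_iff_lt_borderCompletionRank {φ : CNF ℕ} (hE : φ.IsExactWidth 3) (n₀ : ℕ) :
    ¬ φ.Satisfiable ↔
      13 * (φ.length + n₀) < borderCompletionRank (slice₀OfList K (nOf (psi n₀ φ)) (entries (psi n₀ φ)))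
        (slicesOfList K (nOf (psi n₀ φ)) (nOf (psi n₀ φ) + 1) (entries (psi n₀ φ))) := by
  rw [borderCompletionRank_slicesOfList_congr K (tOf_psi n₀ φ), rSeq_eq_sub,
    ← not_exists_numSatClauses_iff_lt_borderCompletionRank K (isWidthEq_two_psi n₀ φ)
      (by rw [length_psi, length_padE3]; omega),
    psi, exists_numSatClauses_gjs_iff_of_isExactWidth (isExactWidth_padE3 hE n₀), satisfiable_padE3_iff]

end Transport

/-! ### §3. The slice ranks of `T_ψ` -/

section SliceRank

variable (K : Type u) [Field K]

/-- Sums of indicator values over a list are `countP`. [folklore] -/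
private theorem sum_map_ite_eq_countP {α : Type*} (l : List α) (P : α → Prop) [DecidablePred P] :
    (l.map fun a => if P a then 1 else 0).sum = l.countP fun a => decide (P a) := by
  induction l with
  | nil => simp
  | cons a l ih =>
    rw [List.map_cons, List.sum_cons, List.countP_cons, ih, Nat.add_comm]
    by_cases h : P a
    · rw [if_pos h, if_pos (decide_eq_true h)]
    · rw [if_neg h, if_neg (by simpa using h)]

/-- Counting indices by a property of the entries is `countP`. [folklore] -/
private theorem card_filter_fin_eq_countP {α : Type*} (l : List α) (P : α → Prop) [DecidablePred P] :
    (Finset.univ.filter fun j : Fin l.length => P (l[j.1]'j.2)).card = l.countP fun a => decide (P a) := by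
  classical
  rw [Finset.card_filter, ← List.sum_ofFn, List.ofFn_getElem_eq_map l fun a => if P a then 1 else 0]
  exact sum_map_ite_eq_countP l P

/-- **The literal positions of a 2-CNF carrying a given renamed variable number at most twice its occurrence
number** (the renaming `rho` is injective on occurring variables: all such positions carry the variable
`vlist[k]`). [cite: BlaserIkenmeyerJindalLysikov2018, Obs. 12 and Obs. 17] -/
theorem card_positions_le_two_mul_varOcc {φ : CNF ℕ} (h2 : IsWidthEq 2 φ) (k : Fin (tOf φ)) :
    (Finset.univ.filter fun p : Fin (pairsFin φ).length × Fin 2 => (clauseLit (pairsFin φ) p.1 p.2).1 = k).card ≤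
      2 * φ.varOcc ((vlist φ).getD k.1 0) := by
  classical
  set v := (vlist φ).getD k.1 0 with hv
  have hlenP : (pairsFin φ).length = φ.length := length_pairsFin φ
  -- the clause of a position carrying the renamed variable `k` contains `v`
  have key : ∀ p : Fin (pairsFin φ).length × Fin 2, (clauseLit (pairsFin φ) p.1 p.2).1 = k →
      v ∈ (φ[p.1.1]'(by rw [← hlenP]; exact p.1.2)).map Prod.fst := by
    rintro ⟨I, A⟩ h
    have hI : I.1 < φ.length := by rw [← hlenP]; exact I.2
    rw [clauseLit_pairsFin] at h
    have hc : φ[I.1] ∈ φ := List.getElem_mem hI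
    have hlen : (φ[I.1]).length = 2 := h2 _ hc
    have hl : litAt φ I.1 A.1 ∈ φ[I.1] := by
      rw [litAt, List.getD_eq_getElem _ _ hI, List.getD_eq_getElem _ _ (by rw [hlen]; exact A.2)]
      exact List.getElem_mem _
    have hrho : rhoN φ (litAt φ I.1 A.1).1 = k.1 := by
      have := congrArg Fin.val h
      simpa [litFin, rho] using this
    have hvar : v = (litAt φ I.1 A.1).1 := by rw [hv, ← hrho, getD_vlist_rhoN φ h2 hc hl]
    rw [hvar]
    exact List.mem_map.2 ⟨_, hl, rfl⟩
  -- so the positions lie over the clauses containing `v`, two slots each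
  set T : Finset (Fin (pairsFin φ).length) :=
    Finset.univ.filter fun I => v ∈ (φ[I.1]'(by rw [← hlenP]; exact I.2)).map Prod.fst with hT
  have hsub : (Finset.univ.filter fun p : Fin (pairsFin φ).length × Fin 2 => (clauseLit (pairsFin φ) p.1 p.2).1 = k) ⊆
      T ×ˢ (Finset.univ : Finset (Fin 2)) := by
    intro p hp
    simp only [Finset.mem_filter, Finset.mem_univ, true_and] at hp
    simp only [Finset.mem_product, hT, Finset.mem_filter, Finset.mem_univ, true_and, and_true]
    exact key p hp
  refine (Finset.card_le_card hsub).trans ?_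
  rw [Finset.card_product, Finset.card_univ, Fintype.card_fin, Nat.mul_comm]
  refine Nat.mul_le_mul_left 2 ?_
  -- `|T| = varOcc φ v`, counted on `Fin φ.length`
  have hTc : T.card = (Finset.univ.filter fun J : Fin φ.length => v ∈ (φ[J.1]'J.2).map Prod.fst).card := by
    refine Finset.card_bij (fun I _ => Fin.cast hlenP I) (fun I hI => ?_) (fun I₁ _ I₂ _ h => ?_) (fun J hJ => ?_)
    · simp only [hT, Finset.mem_filter, Finset.mem_univ, true_and] at hI ⊢
      exact hI
    · exact Fin.ext (by simpa using congrArg Fin.val h)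
    · refine ⟨Fin.cast hlenP.symm J, ?_, Fin.ext rfl⟩
      simp only [hT, Finset.mem_filter, Finset.mem_univ, true_and] at hJ ⊢
      exact hJ
  rw [hTc, card_filter_fin_eq_countP φ (fun c => v ∈ c.map Prod.fst)]
  exact le_of_eq rfl

/-- **The slice ranks of `T_ψ` are bounded by the constant `cOf B = 20 (B + 1)`** for an E3-CNF `φ` with every
variable in at most `B ≥ 1` clauses (slices counted as `n + 1`): the slice of a renamed variable is diagonal with
support on its literal positions, at most `2 · varOcc ψ ≤ 2 · 10 (B + 1)` of them (Garey–Johnson–Stockmeyer gadgets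
mention only the variables of their clause and one fresh variable; the padding adds fresh variables once each).
[cite: BlaserIkenmeyerJindalLysikov2018, Obs. 17 ("rk(A_i) ≤ c for all i for some constant c")] [cite: GareyJohnsonStockmeyer1976, Thm. 1.1 (proof)] -/
theorem rank_slicesOfList_psi_le {φ : CNF ℕ} (hE : φ.IsExactWidth 3) {B : ℕ} (hB : ∀ x, φ.varOcc x ≤ B)
    (h1 : 1 ≤ B) (n₀ : ℕ) (k : Fin (nOf (psi n₀ φ) + 1)) :
    (slicesOfList K (nOf (psi n₀ φ)) (nOf (psi n₀ φ) + 1) (entries (psi n₀ φ)) k).rank ≤ cOf B := by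
  have hk := rank_slicesOfList_entries_le K (psi n₀ φ) (finCongr (tOf_psi n₀ φ).symm k)
  rw [slicesOfList_finCongr] at hk
  refine hk.trans ((card_positions_le_two_mul_varOcc (isWidthEq_two_psi n₀ φ) _).trans ?_)
  have hE' : (padE3 n₀ φ).IsExactWidth 3 := isExactWidth_padE3 hE n₀
  have hB' : ∀ x, (padE3 n₀ φ).varOcc x ≤ B := varOcc_padE3_le_of_le hB h1 n₀
  have h' : (psi n₀ φ).varOcc ((vlist (psi n₀ φ)).getD (finCongr (tOf_psi n₀ φ).symm k).1 0) ≤ 10 * (B + 1) :=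
    varOcc_gjs_le_of_isExactWidth hE' hB' _
  rw [cOf]
  omega

end SliceRank

/-! ### §4. Soundness and completeness of the two tests at the E3SAT level -/

section Tests

variable (K : Type u) [Field K] [Infinite K]

/-- **SOUNDNESS (every infinite field).** For an E3-CNF `φ` with occurrence bound `B ≥ 1` and its instance
`(n, n+1, entries ψ, 13 m′)`: if a guessed block passes the chart test over `K` (slice-rank bound `cOf B`) and its
evaluation value is nonzero in `K`, then `φ` is unsatisfiable ("If yes, then accept" is correct).
[cite: BlaserIkenmeyerJindalLysikov2018, Thm. 4 (proof: "The correctness follows from the construction") and §3 remark after Obs. 17] -/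
theorem not_satisfiable_of_testsC {φ : CNF ℕ} (hE : φ.IsExactWidth 3) {B : ℕ} (hB : ∀ x, φ.varOcc x ≤ B)
    (h1 : 1 ≤ B) (n₀ : ℕ) (Bl : KBlock)
    (hchart : map (Int.castRingHom K)
      (chartCircuitC (nOf (psi n₀ φ)) (nOf (psi n₀ φ) + 1) (cOf B) (13 * (φ.length + n₀)) Bl).eval = 0)
    (heval : ((eval (fun i : Fin (nPos (nOf (psi n₀ φ)) (nOf (psi n₀ φ) + 1)) => entryFn (entries (psi n₀ φ)) i.1)
      (blockPoly (nPos (nOf (psi n₀ φ)) (nOf (psi n₀ φ) + 1)) Bl) : ℤ) : K) ≠ 0) :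
    ¬ φ.Satisfiable :=
  (not_satisfiable_iff_lt_borderCompletionRank K hE n₀).2
    (lt_borderCompletionRank_of_testsC_map K (entries (psi n₀ φ)) Bl (rank_slicesOfList_psi_le K hE hB h1 n₀)
      hchart heval)

/-- **COMPLETENESS FROM EQUATIONS (every infinite field).** If `S` cuts out `C^{n,n+1,cOf B}_{13m′}` exactly at the
instance size `n = nOf ψ` and every member of `S` has a fan-in-two constant-free circuit of size `≤ s` (the
negation of the strengthened conclusion at this `n`), then for an UNSATISFIABLE E3-CNF `φ` some guessed block of
length `≤ s + 1` passes both tests over `K` (the instance tensor lies outside the variety because its border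
completion rank exceeds `13 m′`, whatever its slice ranks).
[cite: BlaserIkenmeyerJindalLysikov2018, §3 remark after Obs. 17 and Thm. 4 (proof: "Such a polynomial is guaranteed to exist by assumption")] -/
theorem exists_block_of_not_satisfiable {φ : CNF ℕ} (hE : φ.IsExactWidth 3) (hφ : ¬ φ.Satisfiable)
    (B n₀ : ℕ) {s : ℕ}
    {S : Set (MvPolynomial (Option (Fin (nOf (psi n₀ φ) + 1)) × Fin (nOf (psi n₀ φ)) × Fin (nOf (psi n₀ φ))) K)}
    (hS : {A | ∀ q ∈ S, eval (tensorPoint K A.1 A.2) q = 0} =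
      bijlVariety K (nOf (psi n₀ φ)) (nOf (psi n₀ φ) + 1) (cOf B) (13 * (φ.length + n₀)))
    (hEasy : ∀ q ∈ S, ∃ P : ArithCircuit K (Option (Fin (nOf (psi n₀ φ) + 1)) × Fin (nOf (psi n₀ φ)) × Fin (nOf (psi n₀ φ))),
      P.IsFanInTwo ∧ P.HasSignConstants ∧ P.Computes q ∧ P.size ≤ s) :
    ∃ Bl : KBlock, Bl.length ≤ s + 1 ∧
      (∀ g ∈ Bl, g.a.idx < nPos (nOf (psi n₀ φ)) (nOf (psi n₀ φ) + 1) + Bl.length ∧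
        g.b.idx < nPos (nOf (psi n₀ φ)) (nOf (psi n₀ φ) + 1) + Bl.length) ∧
      map (Int.castRingHom K)
        (chartCircuitC (nOf (psi n₀ φ)) (nOf (psi n₀ φ) + 1) (cOf B) (13 * (φ.length + n₀)) Bl).eval = 0 ∧
      ((eval (fun i : Fin (nPos (nOf (psi n₀ φ)) (nOf (psi n₀ φ) + 1)) => entryFn (entries (psi n₀ φ)) i.1)
        (blockPoly (nPos (nOf (psi n₀ φ)) (nOf (psi n₀ φ) + 1)) Bl) : ℤ) : K) ≠ 0 := by
  refine exists_block_of_equationsC K (entries (psi n₀ φ)) hS hEasy fun hT => ?_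
  have hlt := (not_satisfiable_iff_lt_borderCompletionRank K hE n₀).1 hφ
  exact absurd hT.1 (not_le.2 hlt)

variable (p : ℕ) [CharP K p]

include K in
/-- **SOUNDNESS read modulo the characteristic** (chart identity mod `p`, evaluation value nonzero mod `p`;
the argument runs through the infinite field `K` of characteristic `p`).
[cite: BlaserIkenmeyerJindalLysikov2018, Thm. 4 (proof) and §3 remark after Obs. 17] -/
theorem not_satisfiable_of_testsC_zmod {φ : CNF ℕ} (hE : φ.IsExactWidth 3) {B : ℕ} (hB : ∀ x, φ.varOcc x ≤ B)
    (h1 : 1 ≤ B) (n₀ : ℕ) (Bl : KBlock)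
    (hchart : map (Int.castRingHom (ZMod p))
      (chartCircuitC (nOf (psi n₀ φ)) (nOf (psi n₀ φ) + 1) (cOf B) (13 * (φ.length + n₀)) Bl).eval = 0)
    (heval : ((eval (fun i : Fin (nPos (nOf (psi n₀ φ)) (nOf (psi n₀ φ) + 1)) => entryFn (entries (psi n₀ φ)) i.1)
      (blockPoly (nPos (nOf (psi n₀ φ)) (nOf (psi n₀ φ) + 1)) Bl) : ℤ) : ZMod p) ≠ 0) :
    ¬ φ.Satisfiable :=
  not_satisfiable_of_testsC K hE hB h1 n₀ Bl ((map_intCast_eq_zero_iff_zmod K p _).2 hchart)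
    ((intCast_ne_zero_iff_zmod K p _).2 heval)

/-- **COMPLETENESS read modulo the characteristic.** [cite: BlaserIkenmeyerJindalLysikov2018, §3 remark after Obs. 17 and Thm. 4 (proof)] -/
theorem exists_block_of_not_satisfiable_zmod {φ : CNF ℕ} (hE : φ.IsExactWidth 3) (hφ : ¬ φ.Satisfiable)
    (B n₀ : ℕ) {s : ℕ}
    {S : Set (MvPolynomial (Option (Fin (nOf (psi n₀ φ) + 1)) × Fin (nOf (psi n₀ φ)) × Fin (nOf (psi n₀ φ))) K)}
    (hS : {A | ∀ q ∈ S, eval (tensorPoint K A.1 A.2) q = 0} =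
      bijlVariety K (nOf (psi n₀ φ)) (nOf (psi n₀ φ) + 1) (cOf B) (13 * (φ.length + n₀)))
    (hEasy : ∀ q ∈ S, ∃ P : ArithCircuit K (Option (Fin (nOf (psi n₀ φ) + 1)) × Fin (nOf (psi n₀ φ)) × Fin (nOf (psi n₀ φ))),
      P.IsFanInTwo ∧ P.HasSignConstants ∧ P.Computes q ∧ P.size ≤ s) :
    ∃ Bl : KBlock, Bl.length ≤ s + 1 ∧
      (∀ g ∈ Bl, g.a.idx < nPos (nOf (psi n₀ φ)) (nOf (psi n₀ φ) + 1) + Bl.length ∧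
        g.b.idx < nPos (nOf (psi n₀ φ)) (nOf (psi n₀ φ) + 1) + Bl.length) ∧
      map (Int.castRingHom (ZMod p))
        (chartCircuitC (nOf (psi n₀ φ)) (nOf (psi n₀ φ) + 1) (cOf B) (13 * (φ.length + n₀)) Bl).eval = 0 ∧
      ((eval (fun i : Fin (nPos (nOf (psi n₀ φ)) (nOf (psi n₀ φ) + 1)) => entryFn (entries (psi n₀ φ)) i.1)
        (blockPoly (nPos (nOf (psi n₀ φ)) (nOf (psi n₀ φ) + 1)) Bl) : ℤ) : ZMod p) ≠ 0 := by
  obtain ⟨Bl, hlen, hidx, hchart, heval⟩ := exists_block_of_not_satisfiable K hE hφ B n₀ hS hEasy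
  exact ⟨Bl, hlen, hidx, (map_intCast_eq_zero_iff_zmod K p _).1 hchart, (intCast_ne_zero_iff_zmod K p _).1 heval⟩

end Tests

end BIJL2018Thm4S

end Literature.Barriers.ValiantsHypothesis

end
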